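import Mathlib
import Summits.NavierStokesRegularity.NavierStokesRegularity.Theorems.EulerZoomLiouvillePowerGaugeEulerLiouvilleEulerianChaeLaw
import Summits.NavierStokesRegularity.NavierStokesRegularity.Theorems.EulerZoomLiouvillePowerGaugeEulerLiouvilleSelfSimilarVorticity
import Summits.NavierStokesRegularity.NavierStokesRegularity.Theorems.EulerZoomLiouvillePowerGaugeEulerLiouvilleSelfSimilarPressure
import Summits.NavierStokesRegularity.NavierStokesRegularity.Theorems.EulerZoomLiouvillePowerGaugeEulerLiouvilleEnergySaturationMember
import Summits.NavierStokesRegularity.NavierStokesRegularity.Theorems.EulerZoomLiouvillePowerGaugeEulerLiouvilleSelfSimilarWeakToClassical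
import HarnessLib

/-!
# THE CHAE-CLASS MEMBER: a self-similar member of the power-gauged Euler class whose `C²` profile has BOUNDED GRADIENT and
# vorticity in `L^q` below Chae's threshold is trivial
# (crux `EulerZoomLiouville.PowerGaugeEulerLiouville` = stmt-NavierStokesRegularity-19832, a crux CLASS of self-similar Euler/NS strata on the
# MODEL lattice — not NS regularity, not E; seat ns-ezl-w3 g8, `--supports stmt-NavierStokesRegularity-19832 --as helper`; nsreg-p2 SEEDS-R53 S2′ (iv):
# «a member needs either a bounded-gradient tameness alternative (cheap, honest, weak) or the E-budget route»)

* `selfSimilar_ae_eq_zero_of_curl_eq_zero` — **the irrotational-profile member, factored**: the three clauses of the crux class at exponent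
  `ρ > 0`, `u(τ) = selfSimilarCollapse (1/(2+ρ)) 0 V τ`, `(V, P)` a classical profile (CIV (3.3)) and `curl V = 0` ⇒ `u = 0` a.e. on the slab
  (`DV` symmetric + trace-free, `A`-gauge growth `∫_{B_L}‖V‖² ≤ cL^{1−2ρ}`, harmonic Liouville `ae_eq_zero_of_symm_traceFree_of_growth`; the body of
  the tree's `selfSimilar_ae_eq_zero_of_hasCompactSupport_curl` after its first line, so that every future «Ω ≡ 0» face is one `exact`);
* `selfSimilar_ae_eq_zero_of_boundedGradient_of_vorticity_integrable` — **the Chae-class stratum** (profile shape): if moreover `‖DV‖ ≤ M`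
  everywhere and `‖curl V‖^q ∈ L¹(ℝ³)` for some `q > 0` with `q(1+M) < 3/(2+ρ)`, then `u = 0` a.e. — by the Eulerian Chae law
  `EulerianChae.curl_eq_zero_of_norm_fderiv_le` (this seat, `…EulerianChaeLaw`);
* `selfSimilar_ae_eq_zero_of_boundedGradient_of_vorticity_allSmallMoments` — Chae's own class: `‖DV‖ ≤ M` and `‖curl V‖^q ∈ L¹` for ALL
  `q ∈ (0, q₁)` (some `q₁ > 0`) ⇒ `u = 0` a.e. (choose `q < min(q₁, 3/((2+ρ)(1+M)))`);
* ★ `Loc.selfSimilar_ae_eq_zero_of_chaeClassC2_profile` — **the same in the E-TAIL binder shape** (`0 < ρ ≤ ½`, `hsw hH hgauge hu hp`, `V ∈ C²`,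
  then the face as explicit hypotheses `hM hq hqM hΩq`): the classical pressure is produced from the `D`-gauge exactly as in the K-SPIKE / ridge
  members (`profile_pressure_weight_of_gaugeD`, `EnergySaturation.locallyIntegrable_pressure_of_weight`,
  `WeakToClassical.exists_isSelfSimilarEulerProfile_of_contDiff`). No new definition: if the LEAD wants it as an `IsKinematicTameProfile`
  alternative «Chae class», the face is the conjunction of the four explicit hypotheses.

Relation to the strata already in the tree: stratum B `selfSimilar_ae_eq_zero_of_vorticity_memLp` (CS13 Thm 4.1: strain `→ 0` at infinity +
`curl V ∈ L^q`, `q < 3/(2+ρ)`) asks DECAY of the gradient but allows any `q` below `3γ`; the Chae class asks only BOUNDEDNESS of the gradient and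
pays with the smaller exponent `q < 3γ/(1+M)`; `selfSimilar_ae_eq_zero_of_hasCompactSupport_curl` is the `M`-free compact-support end.

HONEST FRAMING: Chae 2007 Thm 1.1 (Eulerian form) as a stratum of the MODEL-lattice crux class; NOT a member for the `C²` needle survivor of
ROUND-52 (which violates `sup‖DV‖ < ∞`, SEEDS-R53 S2′ (iv)) — cheap, honest, weak; 19832 OPEN; NS regularity NOT proved; not E.
[cite: Chae2007SelfSimilarEuler, Thm 1.1 p.3; ChaeShvydkoy2013, §4 Thm 4.1 (proof)]
-/

noncomputable section

set_option linter.dupNamespace false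

open MeasureTheory Set Filter Topology Metric Function
open scoped ENNReal NNReal InnerProductSpace RealInnerProductSpace

namespace Summit.NavierStokesRegularity.NavierStokesRegularity.Theorems.PowerGaugeEulerLiouville

open Literature.Analysis Literature.Analysis.FluidPDE

/-- **An exactly self-similar member with an IRROTATIONAL classical profile vanishes** (`ρ > 0`): the three clauses of the crux class for
`(u, p, H, c)`, `u(τ) = selfSimilarCollapse (1/(2+ρ)) 0 V τ` (`τ < 0`), `(V, P)` a classical stationary self-similar Euler profile and
`curl V = 0` give `u = 0` a.e. on the slab: `DV` is symmetric (`inner_fderiv_comm_of_curl_eq_zero`) and trace-free (`div V = 0`), the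
`A`-gauge gives `∫_{B_L}‖V‖² ≤ cL^{1−2ρ}` (`profile_energy_growth_of_gaugeA`), so `V = 0` a.e. (`ae_eq_zero_of_symm_traceFree_of_growth`)
and the member vanishes (`selfSimilar_ae_eq_zero_of_profile`). [folklore; the tree's `selfSimilar_ae_eq_zero_of_hasCompactSupport_curl` minus its first step] -/
theorem selfSimilar_ae_eq_zero_of_curl_eq_zero {ρ : ℝ} (hρ : 0 < ρ)
    {u : ℝ → EuclideanSpace ℝ (Fin 3) → EuclideanSpace ℝ (Fin 3)}
    {H : ℝ → EuclideanSpace ℝ (Fin 3) → EuclideanSpace ℝ (Fin 3) →L[ℝ] EuclideanSpace ℝ (Fin 3)} {c : ℝ≥0}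
    {V : EuclideanSpace ℝ (Fin 3) → EuclideanSpace ℝ (Fin 3)} {P : EuclideanSpace ℝ (Fin 3) → ℝ}
    (hH : HasWeakSpatialGradientOn (slab (EuclideanSpace ℝ (Fin 3)) (Iio 0) isOpen_Iio) u H)
    (hA : ∀ a : ℝ, 0 < a → ENNReal.ofReal (a ^ (2 * ρ)) * cknA a (0 : ℝ × EuclideanSpace ℝ (Fin 3)) u ≤ (c : ℝ≥0∞))
    (hu : ∀ τ : ℝ, τ < 0 → u τ = selfSimilarCollapse (1 / (2 + ρ)) 0 V τ)
    (hprof : IsSelfSimilarEulerProfile (1 / (2 + ρ)) 0 V P) (hcurl0 : curl V = 0) :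
    uncurry u =ᵐ[volume.restrict (Iio (0 : ℝ) ×ˢ (univ : Set (EuclideanSpace ℝ (Fin 3))))] 0 := by
  have hcurl : ∀ y, curl V y = 0 := fun y => congrFun hcurl0 y
  have hV1 : ContDiff ℝ 1 V := hprof.contDiff_velocity.of_le (by norm_num)
  have hVd : Differentiable ℝ V := hprof.differentiable_velocity
  -- the classical gradient is a weak gradient, symmetric and trace-free everywhere
  have hweak : HasWeakGradient V (fderiv ℝ V) := hasWeakGradient_fderiv_of_contDiff hV1
  have hsym : ∀ᵐ x ∂(volume : Measure (EuclideanSpace ℝ (Fin 3))), ∀ v w : EuclideanSpace ℝ (Fin 3),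
      ⟪fderiv ℝ V x v, w⟫ = ⟪fderiv ℝ V x w, v⟫ :=
    ae_of_all _ fun x v w => inner_fderiv_comm_of_curl_eq_zero (hVd x) (hcurl x) v w
  have htr : ∀ᵐ x ∂(volume : Measure (EuclideanSpace ℝ (Fin 3))),
      ∑ j, fderiv ℝ V x (EuclideanSpace.single j (1 : ℝ)) j = 0 := by
    refine ae_of_all _ fun x => ?_
    have h := hprof.divFree x
    rw [VectorCalculus.divergence, trace_eq_sum_coord] at h
    exact h
  -- the `A`-gauge growth, in the shape `∫_{B_r} ≤ ofReal (c r^{1−2ρ})`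
  have hgrowth0 := profile_energy_growth_of_gaugeA hρ hu hA
  have hgrowth : ∀ r : ℝ, (0 : ℝ) < r → 0 < r →
      ∫⁻ x in ball (0 : EuclideanSpace ℝ (Fin 3)) r, ‖V x‖ₑ ^ 2 ≤
        ENNReal.ofReal ((c : ℝ) * r ^ (1 - 2 * ρ)) := by
    intro r _ hr
    have h := hgrowth0 r hr
    rwa [ENNReal.ofReal_mul c.coe_nonneg, ENNReal.ofReal_coe_nnreal]
  have hm : (1 - 2 * ρ : ℝ) < 3 := by linarith
  have hV0 : V =ᵐ[volume] 0 := ae_eq_zero_of_symm_traceFree_of_growth hweak hsym htr hm hgrowth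
  -- a member with vanishing profile vanishes
  have hum : AEStronglyMeasurable (uncurry u)
      (volume.restrict (Iio (0 : ℝ) ×ˢ (univ : Set (EuclideanSpace ℝ (Fin 3))))) := by
    have := hH.locallyIntegrableOn.aestronglyMeasurable
    simpa [slab] using this
  exact selfSimilar_ae_eq_zero_of_profile hum hu hV0

/-- **THE CHAE-CLASS STRATUM** (every `ρ > 0`; profile shape): in the power-gauged class, an exactly self-similar member
`u(τ) = selfSimilarCollapse (1/(2+ρ)) 0 V τ` with a classical profile `(V, P)` whose gradient is BOUNDED, `‖DV‖ ≤ M`, and whose vorticity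
has a finite moment `‖curl V‖^q ∈ L¹(ℝ³)` for some `q > 0` below Chae's threshold, `q(1+M) < 3/(2+ρ)`, vanishes a.e. on the slab: the
Eulerian Chae law (`EulerianChae.curl_eq_zero_of_norm_fderiv_le`) makes the profile irrotational, then `selfSimilar_ae_eq_zero_of_curl_eq_zero`.
[cite: Chae2007SelfSimilarEuler, Thm 1.1 p.3 (Eulerian form)] -/
theorem selfSimilar_ae_eq_zero_of_boundedGradient_of_vorticity_integrable {ρ : ℝ} (hρ : 0 < ρ)
    {u : ℝ → EuclideanSpace ℝ (Fin 3) → EuclideanSpace ℝ (Fin 3)} {p : ℝ → EuclideanSpace ℝ (Fin 3) → ℝ}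
    {H : ℝ → EuclideanSpace ℝ (Fin 3) → EuclideanSpace ℝ (Fin 3) →L[ℝ] EuclideanSpace ℝ (Fin 3)} {c : ℝ≥0}
    {V : EuclideanSpace ℝ (Fin 3) → EuclideanSpace ℝ (Fin 3)} {P : EuclideanSpace ℝ (Fin 3) → ℝ}
    (_hsw : IsSuitableWeakSolutionOn (slab (EuclideanSpace ℝ (Fin 3)) (Iio 0) isOpen_Iio) 0 0 u p)
    (hH : HasWeakSpatialGradientOn (slab (EuclideanSpace ℝ (Fin 3)) (Iio 0) isOpen_Iio) u H)
    (hgauge : ∀ a : ℝ, 0 < a →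
      ENNReal.ofReal (a ^ (2 * ρ)) * cknA a (0 : ℝ × EuclideanSpace ℝ (Fin 3)) u +
          ENNReal.ofReal (a ^ ρ) * cknE a (0 : ℝ × EuclideanSpace ℝ (Fin 3)) H +
        ENNReal.ofReal (a ^ (2 * ρ)) * cknD a (0 : ℝ × EuclideanSpace ℝ (Fin 3)) p ≤ (c : ℝ≥0∞))
    (hu : ∀ τ : ℝ, τ < 0 → u τ = selfSimilarCollapse (1 / (2 + ρ)) 0 V τ)
    (hprof : IsSelfSimilarEulerProfile (1 / (2 + ρ)) 0 V P)
    {M q : ℝ} (hM : ∀ y, ‖fderiv ℝ V y‖ ≤ M) (hq : 0 < q) (hqM : q * (1 + M) < 3 / (2 + ρ))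
    (hΩq : Integrable (fun y => ‖curl V y‖ ^ q)) :
    uncurry u =ᵐ[volume.restrict (Iio (0 : ℝ) ×ˢ (univ : Set (EuclideanSpace ℝ (Fin 3))))] 0 := by
  have hqM' : q * (1 + M) < 3 * (1 / (2 + ρ)) := by rwa [mul_one_div]
  have hcurl0 : curl V = 0 :=
    EulerianChae.curl_eq_zero_of_norm_fderiv_le hprof.isSelfSimilarEulerVorticityProfile hq hM hqM' hΩq
  have hA : ∀ a : ℝ, 0 < a → ENNReal.ofReal (a ^ (2 * ρ)) *
      cknA a (0 : ℝ × EuclideanSpace ℝ (Fin 3)) u ≤ (c : ℝ≥0∞) :=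
    fun a ha => le_trans (le_trans le_self_add le_self_add) (hgauge a ha)
  exact selfSimilar_ae_eq_zero_of_curl_eq_zero hρ hH hA hu hprof hcurl0

/-- **CHAE'S OWN CLASS** (every `ρ > 0`; profile shape): bounded gradient `‖DV‖ ≤ M` and `‖curl V‖^q ∈ L¹(ℝ³)` for ALL `q ∈ (0, q₁)`
(some `q₁ > 0` — «`ω ∈ L^p` for all `p ∈ (0, p₁)`» in Chae's Thm 1.1) ⇒ the member vanishes: apply the stratum at any
`q < min(q₁, 3/((2+ρ)(1+M)))`. [cite: Chae2007SelfSimilarEuler, Thm 1.1 p.3] -/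
theorem selfSimilar_ae_eq_zero_of_boundedGradient_of_vorticity_allSmallMoments {ρ : ℝ} (hρ : 0 < ρ)
    {u : ℝ → EuclideanSpace ℝ (Fin 3) → EuclideanSpace ℝ (Fin 3)} {p : ℝ → EuclideanSpace ℝ (Fin 3) → ℝ}
    {H : ℝ → EuclideanSpace ℝ (Fin 3) → EuclideanSpace ℝ (Fin 3) →L[ℝ] EuclideanSpace ℝ (Fin 3)} {c : ℝ≥0}
    {V : EuclideanSpace ℝ (Fin 3) → EuclideanSpace ℝ (Fin 3)} {P : EuclideanSpace ℝ (Fin 3) → ℝ}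
    (hsw : IsSuitableWeakSolutionOn (slab (EuclideanSpace ℝ (Fin 3)) (Iio 0) isOpen_Iio) 0 0 u p)
    (hH : HasWeakSpatialGradientOn (slab (EuclideanSpace ℝ (Fin 3)) (Iio 0) isOpen_Iio) u H)
    (hgauge : ∀ a : ℝ, 0 < a →
      ENNReal.ofReal (a ^ (2 * ρ)) * cknA a (0 : ℝ × EuclideanSpace ℝ (Fin 3)) u +
          ENNReal.ofReal (a ^ ρ) * cknE a (0 : ℝ × EuclideanSpace ℝ (Fin 3)) H +
        ENNReal.ofReal (a ^ (2 * ρ)) * cknD a (0 : ℝ × EuclideanSpace ℝ (Fin 3)) p ≤ (c : ℝ≥0∞))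
    (hu : ∀ τ : ℝ, τ < 0 → u τ = selfSimilarCollapse (1 / (2 + ρ)) 0 V τ)
    (hprof : IsSelfSimilarEulerProfile (1 / (2 + ρ)) 0 V P)
    {M q₁ : ℝ} (hM : ∀ y, ‖fderiv ℝ V y‖ ≤ M) (hq₁ : 0 < q₁)
    (hΩ : ∀ q : ℝ, 0 < q → q < q₁ → Integrable (fun y => ‖curl V y‖ ^ q)) :
    uncurry u =ᵐ[volume.restrict (Iio (0 : ℝ) ×ˢ (univ : Set (EuclideanSpace ℝ (Fin 3))))] 0 := by
  have hM0 : 0 ≤ M := (norm_nonneg _).trans (hM 0)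
  have hthr : 0 < 3 / (2 + ρ) / (1 + M) := by positivity
  set q : ℝ := min q₁ (3 / (2 + ρ) / (1 + M)) / 2 with hqdef
  have hmin : 0 < min q₁ (3 / (2 + ρ) / (1 + M)) := lt_min hq₁ hthr
  have hq : 0 < q := by positivity
  have hq1 : q < q₁ := by
    have := min_le_left q₁ (3 / (2 + ρ) / (1 + M)); rw [hqdef]; linarith
  have hq2 : q < 3 / (2 + ρ) / (1 + M) := by
    have := min_le_right q₁ (3 / (2 + ρ) / (1 + M)); rw [hqdef]; linarith
  have hqM : q * (1 + M) < 3 / (2 + ρ) := by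
    rwa [lt_div_iff₀ (by positivity : (0 : ℝ) < 1 + M)] at hq2
  exact selfSimilar_ae_eq_zero_of_boundedGradient_of_vorticity_integrable hρ hsw hH hgauge hu hprof hM hq hqM (hΩ q hq hq1)

/-- ★ **THE CHAE-CLASS MEMBER, E-TAIL binder shape** (`0 < ρ ≤ ½`, `V ∈ C²`; the face as four explicit hypotheses: `‖DV‖ ≤ M`, `0 < q`,
`q(1+M) < 3/(2+ρ)`, `‖curl V‖^q ∈ L¹`): in the power-gauge class such a backward self-similar member is trivial, `u = 0` a.e. The classical
pressure of the profile comes from the `D`-gauge (`profile_pressure_weight_of_gaugeD`, `EnergySaturation.locallyIntegrable_pressure_of_weight`,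
`WeakToClassical.exists_isSelfSimilarEulerProfile_of_contDiff`), then `selfSimilar_ae_eq_zero_of_boundedGradient_of_vorticity_integrable`.
[cite: Chae2007SelfSimilarEuler, Thm 1.1 p.3 (Eulerian form)] -/
theorem Loc.selfSimilar_ae_eq_zero_of_chaeClassC2_profile {ρ : ℝ} (hρ : 0 < ρ) (hρ1 : ρ ≤ 1 / 2)
    {u : ℝ → EuclideanSpace ℝ (Fin 3) → EuclideanSpace ℝ (Fin 3)} {p : ℝ → EuclideanSpace ℝ (Fin 3) → ℝ}
    {H : ℝ → EuclideanSpace ℝ (Fin 3) → EuclideanSpace ℝ (Fin 3) →L[ℝ] EuclideanSpace ℝ (Fin 3)} {c : ℝ≥0}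
    (hsw : IsSuitableWeakSolutionOn (slab (EuclideanSpace ℝ (Fin 3)) (Iio 0) isOpen_Iio) 0 0 u p)
    (hH : HasWeakSpatialGradientOn (slab (EuclideanSpace ℝ (Fin 3)) (Iio 0) isOpen_Iio) u H)
    (hgauge : ∀ a : ℝ, 0 < a →
      ENNReal.ofReal (a ^ (2 * ρ)) * cknA a (0 : ℝ × EuclideanSpace ℝ (Fin 3)) u +
          ENNReal.ofReal (a ^ ρ) * cknE a (0 : ℝ × EuclideanSpace ℝ (Fin 3)) H +
        ENNReal.ofReal (a ^ (2 * ρ)) * cknD a (0 : ℝ × EuclideanSpace ℝ (Fin 3)) p ≤ (c : ℝ≥0∞))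
    {V : EuclideanSpace ℝ (Fin 3) → EuclideanSpace ℝ (Fin 3)} {P : EuclideanSpace ℝ (Fin 3) → ℝ}
    (hu : ∀ τ : ℝ, τ < 0 → u τ = selfSimilarCollapse (1 / (2 + ρ)) 0 V τ)
    (hp : ∀ τ : ℝ, τ < 0 → p τ = selfSimilarCollapsePressure (1 / (2 + ρ)) 0 P τ)
    (hV : ContDiff ℝ 2 V)
    {M q : ℝ} (hM : ∀ y, ‖fderiv ℝ V y‖ ≤ M) (hq : 0 < q) (hqM : q * (1 + M) < 3 / (2 + ρ))
    (hΩq : Integrable (fun y => ‖curl V y‖ ^ q)) :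
    uncurry u =ᵐ[volume.restrict (Iio (0 : ℝ) ×ˢ (univ : Set (EuclideanSpace ℝ (Fin 3))))] 0 := by
  have hρ1' : ρ < 1 := by linarith
  -- a classical pressure for the profile (as in K-SPIKE / the ridge members)
  have hD : ∀ a : ℝ, 0 < a → ENNReal.ofReal (a ^ (2 * ρ)) *
      cknD a (0 : ℝ × EuclideanSpace ℝ (Fin 3)) p ≤ (c : ℝ≥0∞) :=
    fun a ha => le_trans le_add_self (hgauge a ha)
  have hpm : AEStronglyMeasurable (uncurry p)
      (volume.restrict (Iio (0 : ℝ) ×ˢ (univ : Set (EuclideanSpace ℝ (Fin 3))))) := by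
    have := hsw.distributional.2.2.1.aestronglyMeasurable
    simpa [slab] using this
  have hPm := aestronglyMeasurable_pressureProfile hpm hp
  have hDprof := profile_pressure_weight_of_gaugeD hρ hρ1' hpm hp hD
  have hP1 : LocallyIntegrable P volume :=
    EnergySaturation.locallyIntegrable_pressure_of_weight hρ1' hPm
      (ENNReal.mul_ne_top ENNReal.ofReal_ne_top ENNReal.coe_ne_top) hDprof
  obtain ⟨P', hprof⟩ :=
    WeakToClassical.exists_isSelfSimilarEulerProfile_of_contDiff hsw.distributional hu hp hV hP1
  exact selfSimilar_ae_eq_zero_of_boundedGradient_of_vorticity_integrable hρ hsw hH hgauge hu hprof hM hq hqM hΩq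

end Summit.NavierStokesRegularity.NavierStokesRegularity.Theorems.PowerGaugeEulerLiouville

end
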